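import Summits.QuantumFields.YangMills.Theorems.UnitScaleTiltProp8ChartDoubleBarDiffBall
import Summits.QuantumFields.YangMills.Theorems.UnitScaleTiltProp8ChartDoubleBarOneStep
import HarnessLib

/-!
# Route `UnitScaleTilt`, crux K1 «MinimiserStabilityRegPr» (stmt-QuantumFields-19200), leaf V2′ `stub_halvingStep` — pillar P3 re-based on print's DOUBLE-BAR chart
# (★★OWNER RULINGS g26-№6∕№7, (S3)): **hCd♭ AND THE SUP LETTER OF RECORD, UNCONDITIONAL** — brick B2 (✓`…ChartDoubleBarIterSmall`, ✓`…ChartDoubleBarDiffBall`) with its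
# displayed one-step letter `hstep` DISCHARGED by brick B1 (✓`…ChartDoubleBarOneStep.norm_dbarAvgU_sub_one_le`, `C₁ = 3800`)

Cell `ym3-torus` (HUMAN RULING D-0037, YM ladder rung R3 — continuum SU(2) YM₃ on the torus is a RUNG, not the Clay problem), width seat `ym-ust-19200-w5` gen 3,
LEAD of (S3).  `--supports stmt-QuantumFields-19200 --as helper`; def-free, 0 sorry, standard axioms.

BY NAME: `oneStepFlat_letter` (B1 in the `∀`-shape B2 displays), `two_le_C₁flat`, `norm_dbarIterU_sub_one_le_two_mul₀` (`‖U̿^{(i)}(e) − 1‖ ≤ 2Lⁱs₀` under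
`30400ℓ²Lⁱs₀ ≤ 1`), ★`differentiableOn_chartLogFlat_weightedBall₀` (hCd♭: `chartLogFlat η D` ℂ-differentiable on `{Y | ∀ b, w 1 b·‖Y b‖ < R}` for every
`60800·ℓ²·L·R ≤ 1`, `η = L^{−(K−n)}`, level weights, collar displayed), ★`norm_chartLogFlat_le_weightedBall₀` (`‖chartLogFlat η D A (j,c)‖ ≤ 8·L·R` there),
`chartLogFlat_hCd_sup_of_adm22` (both from `Adm22 D R′ M`, `2L ≤ R′M + 1`).  Constants: numerals, `ℓ = (d+2)L` and `L` only — k-UNIFORM (RULING №7 (2)).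
These are the inputs brick B3's Cauchy estimate (hCq♭) and the (S6)∕FILE C knits cite without carrying `hstep`.  NOT a claim about the mass gap.

References: T. Bałaban, CMP **102** (1985) 277–309 [Balaban1985Variational] ((20) p.281, (44)–(48) p.285, (156)–(157) p.302); CMP **98** (1985) 17–51
[Balaban1985Averaging] (Prop. 3 (122)–(125) p.36, Prop. 4 (134)–(135) p.38, (89) p.31).
-/

noncomputable section

open scoped BigOperators
open NormedSpace

namespace Summit.QuantumFields.YangMills.Theorems.Prop8ChartDoubleBar

open Literature.MathematicalPhysics.QuantumFieldTheory.Balaban1983to89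
open T4Continuum BlockAveraging
open B5Eq118OneStroke (iterBlockOf)
open B6SectADomainsV1 (Domains)
open B6SectAOperatorsV1 (BondIdx)
open T3ContinuumYM3Torus (T3Family)
open Summit.QuantumFields.YangMills.Theorems.FlatCubeOpsText (Adm22 IsLevWeight)

variable {P : Params}
variable {𝔸 : Type*} [NormedRing 𝔸] [NormedAlgebra ℂ 𝔸] [CompleteSpace 𝔸]

/-! ## The one-step ♭ letter discharged by brick B1: the statements of record without `hstep` -/

/-- **BRICK B1 IN THE `hstep` SHAPE**: the one-step ♭ letter with `C₁ = 3800` (✓`norm_dbarAvgU_sub_one_le`, seat ★w4-19200 g3), η-expanded to the explicit-binder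
`∀`-form the B2 theorems display. [cite: Balaban1985Averaging, Prop. 3 (122)-(125) p.36, (89) p.31] -/
theorem oneStepFlat_letter [NormOneClass 𝔸] :
    ∀ (j : ℕ), j + 1 ≤ P.m + P.K → ∀ (S : GaugeField P j 𝔸ˣ) (c : PBond P (j + 1)) (s : ℝ), 0 ≤ s →
      48 * (((P.d + 2) * P.L : ℕ) : ℝ) * s ≤ 1 →
      (∀ b : PBond P j, (blockOf b.src = c.src ∨ blockOf b.src = c.tgt) → (blockOf b.tgt = c.src ∨ blockOf b.tgt = c.tgt) →
        ‖((S b : 𝔸ˣ) : 𝔸) - 1‖ ≤ s) →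
      ‖((dbarAvgU S c : 𝔸ˣ) : 𝔸) - 1‖ ≤ (P.L : ℝ) * s + 3800 * (((P.d + 2) * P.L : ℕ) : ℝ) ^ 2 * s ^ 2 :=
  fun _ hj _ c _ hs0 hℓs hS => norm_dbarAvgU_sub_one_le hj c hs0 hℓs hS

/-- `2 ≤ 3800`. [folklore] -/
theorem two_le_C₁flat : (2 : ℝ) ≤ 3800 := by norm_num

/-- **k-UNIFORM NEAR-FLATNESS OF `U̿^{(i)}`, UNCONDITIONAL** (part 1 with B1 plugged): `‖U̿^{(i)}(e) − 1‖ ≤ 2·Lⁱ·s₀` on the read territory under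
`30400·ℓ²·Lⁱ·s₀ ≤ 1`. [cite: Balaban1985Averaging, Prop. 4 (134)-(135) p.38] -/
theorem norm_dbarIterU_sub_one_le_two_mul₀ [NormOneClass 𝔸] {i : ℕ} (hi : i ≤ P.m + P.K) (S : Set (Site P i)) (U : GaugeField P 0 𝔸ˣ) {s₀ : ℝ}
    (hs₀ : 0 ≤ s₀) (hbudget : 8 * 3800 * (((P.d + 2) * P.L : ℕ) : ℝ) ^ 2 * (P.L : ℝ) ^ i * s₀ ≤ 1)
    (hU : ∀ b : PBond P 0, iterBlockOf i b.src ∈ S → iterBlockOf i b.tgt ∈ S → ‖((U b : 𝔸ˣ) : 𝔸) - 1‖ ≤ s₀)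
    (e : PBond P i) (hs : e.src ∈ S) (ht : e.tgt ∈ S) :
    ‖((dbarIterU i U e : 𝔸ˣ) : 𝔸) - 1‖ ≤ 2 * ((P.L : ℝ) ^ i * s₀) :=
  norm_dbarIterU_sub_one_le_two_mul two_le_C₁flat oneStepFlat_letter hi S U hs₀ hbudget hU e hs ht

section WeightedDischarged

open scoped Matrix.Norms.L2Operator

/-- **hCd♭ OF RECORD, UNCONDITIONAL**: `chartLogFlat η D` is ℂ-differentiable on the weighted sup-ball of every radius `R` with `60800·ℓ²·L·R ≤ 1`
(`= 16·3800`; k-uniform, numerals and `ℓ = (d+2)L`, `L` only), collar property displayed. [cite: Balaban1985Variational, (20) p.281, (44)-(48) p.285, (156)-(157) p.302] -/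
theorem differentiableOn_chartLogFlat_weightedBall₀ (F : T3Family) (n K : ℕ) (D : Domains (F.P K)) (hDk : D.k = K - n)
    (hcollar : ∀ (i : ℕ) (e : PBond (F.P K) (i + 1)), D.LamBond (i + 1) e → ∀ z : Site (F.P K) i, (blockOf z = e.src ∨ blockOf z = e.tgt) → z ∈ D.Om i)
    {w : ℕ → PBond (F.P K) 0 → ℝ} (hw : IsLevWeight F n K D w)
    {R : ℝ} (hR : 16 * 3800 * ((((F.P K).d + 2) * (F.P K).L : ℕ) : ℝ) ^ 2 * (F.L : ℝ) * R ≤ 1) :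
    DifferentiableOn ℂ
      (chartLogFlat (((F.L : ℝ)⁻¹) ^ (K - n)) D :
        (PBond (F.P K) 0 → Matrix (Fin 2) (Fin 2) ℂ) → BondIdx D → Matrix (Fin 2) (Fin 2) ℂ)
      {Y | ∀ b, w 1 b * ‖Y b‖ < R} :=
  differentiableOn_chartLogFlat_weightedBall F n K D hDk hcollar hw two_le_C₁flat oneStepFlat_letter hR

/-- **THE k-UNIFORM SUP LETTER OF RECORD, UNCONDITIONAL**: `‖chartLogFlat η D A (j,c)‖ ≤ 8·L·R` on the weighted ball, `60800·ℓ²·L·R ≤ 1`.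
[cite: Balaban1985Variational, (20) p.281, (44)-(47) p.285] -/
theorem norm_chartLogFlat_le_weightedBall₀ (F : T3Family) (n K : ℕ) (D : Domains (F.P K)) (hDk : D.k = K - n)
    (hcollar : ∀ (i : ℕ) (e : PBond (F.P K) (i + 1)), D.LamBond (i + 1) e → ∀ z : Site (F.P K) i, (blockOf z = e.src ∨ blockOf z = e.tgt) → z ∈ D.Om i)
    {w : ℕ → PBond (F.P K) 0 → ℝ} (hw : IsLevWeight F n K D w)
    {R : ℝ} (hR : 16 * 3800 * ((((F.P K).d + 2) * (F.P K).L : ℕ) : ℝ) ^ 2 * (F.L : ℝ) * R ≤ 1)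
    {A : PBond (F.P K) 0 → Matrix (Fin 2) (Fin 2) ℂ} (hA : ∀ b, w 1 b * ‖A b‖ < R) (idx : BondIdx D) :
    ‖chartLogFlat (((F.L : ℝ)⁻¹) ^ (K - n)) D A idx‖ ≤ 8 * (F.L : ℝ) * R :=
  norm_chartLogFlat_le_weightedBall F n K D hDk hcollar hw two_le_C₁flat oneStepFlat_letter hR hA idx

/-- Both, with the collar from (2.2)-admissibility (`2L ≤ R′M + 1`). [cite: Balaban1985Variational, (44)-(48) p.285; Balaban1984PropagatorsII, (2.2) p.224] -/
theorem chartLogFlat_hCd_sup_of_adm22 (F : T3Family) (n K : ℕ) (D : Domains (F.P K)) (hDk : D.k = K - n) {R' M : ℕ}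
    (hAdm : Adm22 D R' M) (hRM : 2 * (F.P K).L ≤ R' * M + 1)
    {w : ℕ → PBond (F.P K) 0 → ℝ} (hw : IsLevWeight F n K D w)
    {R : ℝ} (hR : 16 * 3800 * ((((F.P K).d + 2) * (F.P K).L : ℕ) : ℝ) ^ 2 * (F.L : ℝ) * R ≤ 1) :
    DifferentiableOn ℂ
      (chartLogFlat (((F.L : ℝ)⁻¹) ^ (K - n)) D :
        (PBond (F.P K) 0 → Matrix (Fin 2) (Fin 2) ℂ) → BondIdx D → Matrix (Fin 2) (Fin 2) ℂ)
      {Y | ∀ b, w 1 b * ‖Y b‖ < R} ∧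
    ∀ {A : PBond (F.P K) 0 → Matrix (Fin 2) (Fin 2) ℂ}, (∀ b, w 1 b * ‖A b‖ < R) → ∀ idx : BondIdx D,
      ‖chartLogFlat (((F.L : ℝ)⁻¹) ^ (K - n)) D A idx‖ ≤ 8 * (F.L : ℝ) * R :=
  differentiableOn_chartLogFlat_weightedBall_of_adm22 F n K D hDk hAdm hRM hw two_le_C₁flat oneStepFlat_letter hR

end WeightedDischarged

end Summit.QuantumFields.YangMills.Theorems.Prop8ChartDoubleBar

end
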